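import Summits.QuantumFields.YangMills.Theorems.UnitScaleTiltFluctuationComparisonRegPrGlobalSlackKernelLegResidualFarV4
import Summits.QuantumFields.YangMills.Theorems.UnitScaleTiltFluctuationComparisonRegPrGlobalSlackCanonicalEndToEnd
import Summits.QuantumFields.YangMills.Theorems.UnitScaleTiltFluctuationComparisonRegPrGlobalSlackTwoProfile
import Summits.QuantumFields.YangMills.Theorems.UnitScaleTiltFluctuationComparisonRegPrGlobalSlackKernelLegResidualFarProfile
import HarnessLib

/-!
# `UnitScaleTiltFluctuationComparisonRegPrGlobalSlackKernelLegResidualFarProfileV4` — THE v4 TWIN (★★OWNER RULING g26-№14 (F-2b); P22b profile branch, width seat ym-ust-20520-w2 g4; skeleton v5kD; record-free decls imported from `…GlobalSlackKernelLegResidualFarProfile`) of `…GlobalSlackKernelLegResidualFarProfile` — THE (61)-BORN FAR ROW (F^Λ) IS A THEOREM AT EVERY LOG-PROFILE `p₁ ≥ p₀ + r₀`, HENCE THE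
# WHOLE BIRTH FAR ROW AND THE RESIDUAL ROW (R3) ⇐ (N) ∧ (M1) THERE (crux `FluctuationComparisonRegPrIntL`, stmt-QuantumFields-20520, skeleton v5kC, STUB 3⁗χ
# `stub_globalTwoRunSlackFamChiV4`; width seat ym-ust-20520-w1 g2, successor of w1 g0; count-neutral; YM₃ on the 3-torus is ladder rung R3, not the Clay problem)

WHY.  ★w1 g0's seven-row display obligation `GlobalSlackKernelLeg.K1aLegRowsDisplayChiV4` (p586902) keeps ONE far display, (F^Λ) `LambdaFarSmallOwnRows q b₀ p₀ κ C_Λ`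
(`…KernelLegResidualFar`, p586331): at the RECORD's profile `p₀` the (61)-born far terms of G3D-07 (`(q K).𝔄.Λc k`, g-FREE amplitude `C63·e^{−κ𝓛}`, size
`g_k⁷(r(g_k)p(g_k))⁷`) are NOT `≤ C·θ_{b₀,p₀}(K−k−1)⁷` with an `n`-uniform `C` — the collar polylogarithm `r(g_k)⁷ = (1 + log g_k⁻¹)^{7r₀}` has no spare coupling to absorb it
(★w1 g0 located item (b), ★w3 g0 `…StepFarTheta` «LOCATED, NOT TOUCHED»).  But the polylogarithm IS a profile shift: `r(g)·g·p_{p₀}(g) = g·p_{p₀+r₀}(g)`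
(`GlobalSlackCanonicalPolymers.rFun_mul_mul_pFun`), so `g_k⁷(r(g_k)p(g_k))⁷ = θ_{b₀,p₀+r₀}(K−k)⁷` EXACTLY, and ★ym-ust-19935-r1 g5's HIGHER-PROFILE DOOR
(`GlobalSlackOn.regPrIntL_of_recChiV4_slackOnChi_higherProfile_allL`, `…GlobalSlackHigherProfile`: the crux reads the slack row at ANY `p₁ ≥ 𝔠.p₀`) makes the profile
`p₁ = p₀ + r₀` admissible currency.  This file cashes that in, per run, from the displayed rows G3D-06/G3D-07 ALONE (every history, every field — no window):

* §1 `gpow_mul_rp_pow_eq_θBal_pow` — the letter: `g_k⁷·(r(g_k)·p(g_k))⁷ = θ_{b₀,p₀+r₀}(K−k)⁷` along the steps `k ≤ K` of run `K`;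
* §2 **`abs_farLambda_le_theta7_at_of_farRow`** (`|far^Λ_X(h,W)| ≤ Cfar·C63·θ_{b₀,p₀+r₀}(K−k)⁷·e^{−κ·dj X}`) and **`abs_farLambda_le_theta7_profile_of_farRow`** (at any `p₁ ≥ p₀ + r₀`, one
  height up: `≤ Cfar·C63·((√L)⁻¹(1+log √L)^{p₁})⁷ · e^{−κ·dj X} · θ_{b₀,p₁}(K−k−1)⁷`, by `GlobalSlackOn.θBal_mono_p` + ★w3's `θBal_succ_pow_le`);
* §3 **`lambdaFarSmallOwnRows_of_record`**: `p₀ + r₀ ≤ p₁ → LambdaFarSmallOwnRows q 𝔠.b₀ p₁ 𝔠.κ (Cfar·C63·((√L)⁻¹(1+log √L)^{p₁})⁷)` — (F^Λ) DISCHARGED at the door's profiles;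
* §4 the 𝔖-half re-read at `p₁` (`abs_far_le_theta7_profile_of_farRow`, ★w3's `abs_far_le_theta7_at_of_farRow` + the same two moves) and **`birthFarSmallOwnRows_of_record`**:
  `p₀ + r₀ ≤ p₁ → BirthFarSmallOwnRows q 𝔠.b₀ p₁ 𝔠.κ ((Cfar·C25·tlConst(7r₀,1) + Cfar·C63)·((√L)⁻¹(1+log √L)^{p₁})⁷)` — BOTH halves theorems;
* §5 **`remainderSmallOwnΦ_of_jets_profileRows`** (+ χ twin): at every `p₁ ≥ p₀ + r₀` the residual row (R3) `RemainderSmallOwnΦ … 𝔠.b₀ p₁ 𝔠.κ C_F` follows from (N) `NewLevelIsBirthRows`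
  and (M1) `OldTermsAreJetsOwnRows` ALONE (`remainderSmallOwnΦ_of_splitRows` is profile-generic) — the display list at `p₁` has SIX rows, (F^Λ) gone.
HONEST FRAMING: bookkeeping inequalities over two displayed rows of the (α) record and hypothesis schemas; nothing of [Balaban1985UV3]/[King1986] is asserted; registry
untouched (`--supports stmt-QuantumFields-20520`); no claim on the stub, the crux, d = 4 or the mass gap.

References: T. Bałaban, CMP 102 (1985) 255–275 [Balaban1985UV3] ((5) p.256, (7) p.257, (25) p.262, p.264 L14–20, (57) p.270, (61)–(63) pp.271–272, p.265 L13–16);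
C. King, CMP 102 (1986) 649–677 [King1986] (Thm 3.4 (3.9) p.656).
-/

set_option autoImplicit false

noncomputable section

open scoped BigOperators
open Literature.MathematicalPhysics.QuantumFieldTheory.Balaban1983to89
open Literature.MathematicalPhysics.QuantumFieldTheory.Balaban1983to89.T3ContinuumYM3Torus
open Literature.MathematicalPhysics.QuantumFieldTheory.Balaban1983to89.T3UnitScaleTilt
open Literature.MathematicalPhysics.QuantumFieldTheory.Balaban1983to89.T3LevelShift
open Literature.MathematicalPhysics.QuantumFieldTheory.Balaban1983to89.T3AlphaInputsAC
open Literature.MathematicalPhysics.QuantumFieldTheory.Balaban1983to89.T3AlphaPolymerSocket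
open Literature.MathematicalPhysics.QuantumFieldTheory.Balaban1983to89.T3AlphaInputsACTwoRun
open Literature.MathematicalPhysics.QuantumFieldTheory.Balaban1983to89.T3AlphaInputsACTwoRunLevel
open Literature.MathematicalPhysics.QuantumFieldTheory.Balaban1983to89.TreeLengthTorus (tsys)
open Literature.MathematicalPhysics.QuantumFieldTheory.Balaban1985CMP102
open Literature.MathematicalPhysics.QuantumFieldTheory.Balaban1985CMP102.Setting
open Summit.QuantumFields.Balaban3D.Carriers
open Summit.QuantumFields.Balaban3D.Proofs.Primitives
open Summit.QuantumFields.Balaban3D.Proofs.GroupModelLieC (lieC)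
open Summit.QuantumFields.Balaban3D.Proofs.NewbornJet (tlConst tlConst_nonneg)
open Summit.QuantumFields.Balaban3D.Proofs.ScalesArithmetic (gk_pos gk_le_one)
open Summit.QuantumFields.YangMills.Theorems
open Summit.QuantumFields.YangMills.Theorems.GlobalSlackKernelMatching
open Summit.QuantumFields.YangMills.Theorems.GlobalSlackCanonicalPolymers

open Literature.MathematicalPhysics.QuantumFieldTheory.Balaban1985CMP102.Binders (FarTermsDecayAsCited)

namespace Summit.QuantumFields.YangMills.Theorems.GlobalSlackKernelLeg

variable {F : T3Family} {𝔠 : AlphaConsts F.L (suGroupModel 2).N} {γ : ℝ} {hγ : 0 < γ} {hγ1 : γ ≤ (min 𝔠.gamma0 1) ^ 2}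

/-! ## §1 The letter: the collar polylogarithm is a profile shift -/

-- (record-free `gpow_mul_rp_pow_eq_θBal_pow`: imported from the v3 module, not restated)

-- (record-free `heightUpFactor_nonneg`: imported from the v3 module, not restated)

/-! ## §2 The (61)-born far terms in seventh-order currency at the shifted profile, per run, every history and field -/

section Far

variable (q : ∀ K, AlphaInputsT3AC.PkgCoreRows F 𝔠 γ hγ hγ1 K) {H C : Type*}

/-- **THE (61)-BORN FAR TERMS ARE `θ_{b₀,p₀+r₀}(K − k)⁷`-SMALL** (un-shifted height): for `k + 1 ≤ K`, every step-`k` domain `X`, history `h` and field `W`,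
`|((q K).𝔄.Λc k).far X h W| ≤ Cfar·C63·θBal F.L γ b₀ (p₀ + r₀) (K − k)⁷·e^{−κ·dj X}` — the displayed G3D-07 row `(𝔄.Λc k).far_le`
(`|far^Λ_X| ≤ Cfar·(C63·e^{−κ dj X})·g_k⁷(r(g_k)p(g_k))⁷`) read through §1's letter.  No spare coupling is used: the polylogarithm moves into the profile.
[cite: Balaban1985UV3, (61)-(63) pp.271-272, p.265 L13-16, p.264 L14-20, (7) p.257] -/
theorem abs_farLambda_le_theta7_at_of_farRow (K k : ℕ) (hk : k + 1 ≤ K)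
    (far : (tsys 3 (nblkOf (SK F 𝔠 γ hγ hγ1 K) 𝔠.lane.carrier k)).Dom → H → C → ℝ)
    (hfar : FarTermsDecayAsCited far (fun Y => 𝔠.C63 * Real.exp (-(𝔠.κ * (tsys 3 (nblkOf (SK F 𝔠 γ hγ hγ1 K) 𝔠.lane.carrier k)).dj Y))) 𝔠.Cfar
      ((SK F 𝔠 γ hγ hγ1 K).gk k ^ 7 * (B10.rFun 𝔠.r₀ ((SK F 𝔠 γ hγ hγ1 K).gk k) * B10.pFun 𝔠.b₀ 𝔠.p₀ ((SK F 𝔠 γ hγ hγ1 K).gk k)) ^ 7))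
    (X : (tsys 3 (nblkOf (SK F 𝔠 γ hγ hγ1 K) 𝔠.lane.carrier k)).Dom) (h : H) (W : C) :
    |far X h W| ≤ 𝔠.Cfar * 𝔠.C63 * θBal F.L γ 𝔠.b₀ (𝔠.p₀ + 𝔠.r₀) (K - k) ^ 7 *
      Real.exp (-(𝔠.κ * (tsys 3 (nblkOf (SK F 𝔠 γ hγ hγ1 K) 𝔠.lane.carrier k)).dj X)) := by
  have hfar' : |far X h W| ≤ 𝔠.Cfar * ((𝔠.C63 * Real.exp (-(𝔠.κ * (tsys 3 (nblkOf (SK F 𝔠 γ hγ hγ1 K) 𝔠.lane.carrier k)).dj X))) *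
      ((SK F 𝔠 γ hγ hγ1 K).gk k ^ 7 * (B10.rFun 𝔠.r₀ ((SK F 𝔠 γ hγ hγ1 K).gk k) * B10.pFun 𝔠.b₀ 𝔠.p₀ ((SK F 𝔠 γ hγ hγ1 K).gk k)) ^ 7)) :=
    hfar X h W
  rw [gpow_mul_rp_pow_eq_θBal_pow K k (by omega) 7] at hfar'
  refine hfar'.trans (le_of_eq ?_)
  ring

/-- **THE (61)-BORN FAR TERMS IN THE RESIDUAL ROW'S CURRENCY AT ANY PROFILE `p₁ ≥ p₀ + r₀`, AT THE BIRTH READING** (`n = K − k − 1`): for `k + 1 ≤ K`, every `X`, `h`, `W`,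
`|((q K).𝔄.Λc k).far X h W| ≤ (Cfar·C63·((√L)⁻¹(1 + log √L)^{p₁})⁷)·e^{−κ·dj X}·θBal F.L γ b₀ p₁ (K − k − 1)⁷` — `abs_farLambda_le_theta7_at_of_farRow`, the thresholds monotone in the
log-power (`GlobalSlackOn.θBal_mono_p`) and `θ` one height up at `p₁` (`θBal_succ_pow_le`, window-free). [cite: Balaban1985UV3, (61)-(63) pp.271-272, (5) p.256, (7) p.257, (57) p.270] -/
theorem abs_farLambda_le_theta7_profile_of_farRow {p₁ : ℝ} (hp : 𝔠.p₀ + 𝔠.r₀ ≤ p₁) (K k : ℕ) (hk : k + 1 ≤ K)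
    (far : (tsys 3 (nblkOf (SK F 𝔠 γ hγ hγ1 K) 𝔠.lane.carrier k)).Dom → H → C → ℝ)
    (hfar : FarTermsDecayAsCited far (fun Y => 𝔠.C63 * Real.exp (-(𝔠.κ * (tsys 3 (nblkOf (SK F 𝔠 γ hγ hγ1 K) 𝔠.lane.carrier k)).dj Y))) 𝔠.Cfar
      ((SK F 𝔠 γ hγ hγ1 K).gk k ^ 7 * (B10.rFun 𝔠.r₀ ((SK F 𝔠 γ hγ hγ1 K).gk k) * B10.pFun 𝔠.b₀ 𝔠.p₀ ((SK F 𝔠 γ hγ hγ1 K).gk k)) ^ 7))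
    (X : (tsys 3 (nblkOf (SK F 𝔠 γ hγ hγ1 K) 𝔠.lane.carrier k)).Dom) (h : H) (W : C) :
    |far X h W| ≤
      (𝔠.Cfar * 𝔠.C63 * ((Real.sqrt F.L)⁻¹ * (1 + Real.log (Real.sqrt F.L)) ^ p₁) ^ 7) *
        Real.exp (-(𝔠.κ * (tsys 3 (nblkOf (SK F 𝔠 γ hγ hγ1 K) 𝔠.lane.carrier k)).dj X)) * θBal F.L γ 𝔠.b₀ p₁ (K - k - 1) ^ 7 := by
  have hL : 1 ≤ F.L := F.hL.2.le
  have hγ1' : γ ≤ 1 := hγ1.trans (sq_min_one_le _ 𝔠.gamma0_pos)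
  have hp₁ : 0 ≤ p₁ := le_trans 𝔠.r₀_add_p₀_nonneg (by linarith)
  -- raise the profile at height `K − k`
  have hmono : θBal F.L γ 𝔠.b₀ (𝔠.p₀ + 𝔠.r₀) (K - k) ^ 7 ≤ θBal F.L γ 𝔠.b₀ p₁ (K - k) ^ 7 :=
    pow_le_pow_left₀ (T3MinimiserStabilityReduction.θBal_pos hL hγ hγ1' 𝔠.b₀_pos _ _).le
      (GlobalSlackOn.θBal_mono_p hL hγ hγ1' 𝔠.b₀_pos.le hp (K - k)) 7
  -- one height up at `p₁`
  have hup : θBal F.L γ 𝔠.b₀ p₁ (K - k) ^ 7 ≤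
      ((Real.sqrt F.L)⁻¹ * (1 + Real.log (Real.sqrt F.L)) ^ p₁) ^ 7 * θBal F.L γ 𝔠.b₀ p₁ (K - k - 1) ^ 7 := by
    rw [show K - k = (K - k - 1) + 1 by omega]
    exact θBal_succ_pow_le hL hγ hγ1' 𝔠.b₀_pos.le hp₁ (K - k - 1) 7
  have hc : 0 ≤ 𝔠.Cfar * 𝔠.C63 := mul_nonneg 𝔠.Cfar_nonneg 𝔠.C63_nonneg
  have he : 0 ≤ Real.exp (-(𝔠.κ * (tsys 3 (nblkOf (SK F 𝔠 γ hγ hγ1 K) 𝔠.lane.carrier k)).dj X)) := (Real.exp_pos _).le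
  calc |far X h W|
      ≤ 𝔠.Cfar * 𝔠.C63 * θBal F.L γ 𝔠.b₀ (𝔠.p₀ + 𝔠.r₀) (K - k) ^ 7 *
          Real.exp (-(𝔠.κ * (tsys 3 (nblkOf (SK F 𝔠 γ hγ hγ1 K) 𝔠.lane.carrier k)).dj X)) := abs_farLambda_le_theta7_at_of_farRow K k hk far hfar X h W
    _ ≤ 𝔠.Cfar * 𝔠.C63 * (((Real.sqrt F.L)⁻¹ * (1 + Real.log (Real.sqrt F.L)) ^ p₁) ^ 7 * θBal F.L γ 𝔠.b₀ p₁ (K - k - 1) ^ 7) *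
          Real.exp (-(𝔠.κ * (tsys 3 (nblkOf (SK F 𝔠 γ hγ hγ1 K) 𝔠.lane.carrier k)).dj X)) :=
        mul_le_mul_of_nonneg_right (mul_le_mul_of_nonneg_left (hmono.trans hup) hc) he
    _ = _ := by ring

/-! ## §3 (F^Λ) discharged at the door's profiles -/

/-- **(F^Λ) IS A THEOREM AT EVERY PROFILE `p₁ ≥ p₀ + r₀`**: `LambdaFarSmallOwnRows q 𝔠.b₀ p₁ 𝔠.κ (Cfar·C63·((√L)⁻¹(1 + log √L)^{p₁})⁷)` — ★w1 g0's one remaining far display of the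
seven-row obligation `K1aLegRowsDisplayChiV4`, read at the profiles of ★r1 g5's higher-profile door, follows from the displayed G3D-07 row alone (`abs_farLambda_le_theta7_profile_of_farRow` at
the trivial history).  At the record's own profile `p₀` it does not (★w1 g0 located item (b)); nothing here changes that. [cite: Balaban1985UV3, (61)-(63) pp.271-272, (57) p.270, (7) p.257] -/
theorem lambdaFarSmallOwnRows_of_record {p₁ : ℝ} (hp : 𝔠.p₀ + 𝔠.r₀ ≤ p₁) :
    LambdaFarSmallOwnRows q 𝔠.b₀ p₁ 𝔠.κ (𝔠.Cfar * 𝔠.C63 * ((Real.sqrt F.L)⁻¹ * (1 + Real.log (Real.sqrt F.L)) ^ p₁) ^ 7) :=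
  fun K k hk X _ W => abs_farLambda_le_theta7_profile_of_farRow hp K k hk _ ((q K).𝔄.Λc k).far_le X (Hist.triv (F.P K) (k + 1)) W

/-! ## §4 The step-chart half re-read at `p₁` and the whole birth far row -/

/-- **THE STEP RECORD'S FAR TERMS IN THE RESIDUAL ROW'S CURRENCY AT ANY PROFILE `p₁ ≥ p₀`**: for `b + 1 ≤ K`, every `X`, `h`, `W`,
`|((q K).𝔖 b).far X h W| ≤ (Cfar·C25·tlConst(7r₀,1)·((√L)⁻¹(1 + log √L)^{p₁})⁷)·θBal F.L γ b₀ p₁ (K − b − 1)⁷·e^{−κ·dj X}` — ★w3 g0's `abs_far_le_theta7_at_of_farRow` (G3D-06, the spare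
coupling absorbs `r(g_b)⁷`), then `θBal_mono_p` and `θBal_succ_pow_le` at `p₁`. [cite: Balaban1985UV3, p.264 L14-20, (25) p.262, (5) p.256, (7) p.257, (57) p.270] -/
theorem abs_far_le_theta7_profile_of_farRow {p₁ : ℝ} (hp : 𝔠.p₀ ≤ p₁) (K b : ℕ) (hb : b + 1 ≤ K)
    (far : (tsys 3 (nblkOf (SK F 𝔠 γ hγ hγ1 K) 𝔠.lane.carrier b)).Dom → H → C → ℝ)
    (hfar : FarTermsDecayAsCited far
      (fun Y => 𝔠.C25 * (SK F 𝔠 γ hγ hγ1 K).gk b * Real.exp (-(𝔠.κ * (tsys 3 (nblkOf (SK F 𝔠 γ hγ hγ1 K) 𝔠.lane.carrier b)).dj Y)))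
      𝔠.Cfar ((SK F 𝔠 γ hγ hγ1 K).gk b ^ 7 * (B10.rFun 𝔠.r₀ ((SK F 𝔠 γ hγ hγ1 K).gk b) * B10.pFun 𝔠.b₀ 𝔠.p₀ ((SK F 𝔠 γ hγ hγ1 K).gk b)) ^ 7))
    (X : (tsys 3 (nblkOf (SK F 𝔠 γ hγ hγ1 K) 𝔠.lane.carrier b)).Dom) (h : H) (W : C) :
    |far X h W| ≤
      (𝔠.Cfar * 𝔠.C25 * tlConst (7 * 𝔠.r₀) 1 * ((Real.sqrt F.L)⁻¹ * (1 + Real.log (Real.sqrt F.L)) ^ p₁) ^ 7) *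
        θBal F.L γ 𝔠.b₀ p₁ (K - b - 1) ^ 7 * Real.exp (-(𝔠.κ * (tsys 3 (nblkOf (SK F 𝔠 γ hγ hγ1 K) 𝔠.lane.carrier b)).dj X)) := by
  have hL : 1 ≤ F.L := F.hL.2.le
  have hγ1' : γ ≤ 1 := hγ1.trans (sq_min_one_le _ 𝔠.gamma0_pos)
  have hp₁ : 0 ≤ p₁ := 𝔠.p₀_pos.le.trans hp
  have hmono : θBal F.L γ 𝔠.b₀ 𝔠.p₀ (K - b) ^ 7 ≤ θBal F.L γ 𝔠.b₀ p₁ (K - b) ^ 7 :=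
    pow_le_pow_left₀ (T3MinimiserStabilityReduction.θBal_pos hL hγ hγ1' 𝔠.b₀_pos _ _).le
      (GlobalSlackOn.θBal_mono_p hL hγ hγ1' 𝔠.b₀_pos.le hp (K - b)) 7
  have hup : θBal F.L γ 𝔠.b₀ p₁ (K - b) ^ 7 ≤
      ((Real.sqrt F.L)⁻¹ * (1 + Real.log (Real.sqrt F.L)) ^ p₁) ^ 7 * θBal F.L γ 𝔠.b₀ p₁ (K - b - 1) ^ 7 := by
    rw [show K - b = (K - b - 1) + 1 by omega]
    exact θBal_succ_pow_le hL hγ hγ1' 𝔠.b₀_pos.le hp₁ (K - b - 1) 7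
  have hc : 0 ≤ 𝔠.Cfar * 𝔠.C25 * tlConst (7 * 𝔠.r₀) 1 := by
    have := 𝔠.Cfar_nonneg; have := 𝔠.C25_nonneg
    have := tlConst_nonneg (q := 7 * 𝔠.r₀) (c := 1) (by linarith [𝔠.one_le_r₀]) one_pos
    positivity
  have he : 0 ≤ Real.exp (-(𝔠.κ * (tsys 3 (nblkOf (SK F 𝔠 γ hγ hγ1 K) 𝔠.lane.carrier b)).dj X)) := (Real.exp_pos _).le
  calc |far X h W|
      ≤ 𝔠.Cfar * 𝔠.C25 * tlConst (7 * 𝔠.r₀) 1 * θBal F.L γ 𝔠.b₀ 𝔠.p₀ (K - b) ^ 7 *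
          Real.exp (-(𝔠.κ * (tsys 3 (nblkOf (SK F 𝔠 γ hγ hγ1 K) 𝔠.lane.carrier b)).dj X)) := abs_far_le_theta7_at_of_farRow K b hb far hfar X h W
    _ ≤ 𝔠.Cfar * 𝔠.C25 * tlConst (7 * 𝔠.r₀) 1 *
          (((Real.sqrt F.L)⁻¹ * (1 + Real.log (Real.sqrt F.L)) ^ p₁) ^ 7 * θBal F.L γ 𝔠.b₀ p₁ (K - b - 1) ^ 7) *
          Real.exp (-(𝔠.κ * (tsys 3 (nblkOf (SK F 𝔠 γ hγ hγ1 K) 𝔠.lane.carrier b)).dj X)) :=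
        mul_le_mul_of_nonneg_right (mul_le_mul_of_nonneg_left (hmono.trans hup) hc) he
    _ = _ := by ring

/-- **THE WHOLE BIRTH FAR ROW IS A THEOREM AT EVERY PROFILE `p₁ ≥ p₀ + r₀`**:
`BirthFarSmallOwnRows q 𝔠.b₀ p₁ 𝔠.κ ((Cfar·C25·tlConst(7r₀,1) + Cfar·C63)·((√L)⁻¹(1 + log √L)^{p₁})⁷)` — the 𝔖-half `abs_far_le_theta7_profile_of_farRow` plus the Λ-half
`abs_farLambda_le_theta7_profile_of_farRow`, at the trivial history.  Compare ★w1 g0's `birthFarSmallOwn_of_lambdaRows` (profile `p₀`, Λ-half displayed). [cite: Balaban1985UV3, (57) p.270, p.264 L15-16, (61)-(63) pp.271-272] -/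
theorem birthFarSmallOwnRows_of_record {p₁ : ℝ} (hp : 𝔠.p₀ + 𝔠.r₀ ≤ p₁) :
    BirthFarSmallOwnRows q 𝔠.b₀ p₁ 𝔠.κ
      ((𝔠.Cfar * 𝔠.C25 * tlConst (7 * 𝔠.r₀) 1 + 𝔠.Cfar * 𝔠.C63) * ((Real.sqrt F.L)⁻¹ * (1 + Real.log (Real.sqrt F.L)) ^ p₁) ^ 7) := by
  intro K k hk X _ W
  have hp' : 𝔠.p₀ ≤ p₁ := le_trans (le_add_of_nonneg_right (le_trans zero_le_one 𝔠.one_le_r₀)) hp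
  have h𝔖 := abs_far_le_theta7_profile_of_farRow hp' K k hk _ ((q K).runRows.steps k hk).far_le X (Hist.triv (F.P K) (k + 1)) W
  have hΛ := abs_farLambda_le_theta7_profile_of_farRow hp K k hk _ ((q K).𝔄.Λc k).far_le X (Hist.triv (F.P K) (k + 1)) W
  refine (abs_add_le _ _).trans ((add_le_add h𝔖 hΛ).trans (le_of_eq ?_))
  ring

end Far

/-! ## §5 The residual row (R3) at the door's profiles from (N) ∧ (M1) alone -/

section Residual

/-- **THE RESIDUAL ROW (R3) AT EVERY PROFILE `p₁ ≥ p₀ + r₀` FROM «NEW LEVEL IS BIRTH» ∧ «OLD TERMS ARE JETS» ALONE**, at the core datum: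
`RemainderSmallOwnΦ (dataOfCoreRows q (canonPolymerRows q)) (residualRemRows q Φ e B) 𝔠.b₀ p₁ 𝔠.κ ((Cfar·C25·tlConst(7r₀,1) + Cfar·C63)·((√L)⁻¹(1 + log √L)^{p₁})⁷)` —
★w1 g0's profile-generic `remainderSmallOwnΦ_of_splitRows` fed with `birthFarSmallOwnRows_of_record`.  Compare `remainderSmallOwnΦ_of_jets_lambdaRows` (profile `p₀`, needs the display (F^Λ)).
[cite: Balaban1985UV3, (43) p.266, (57) p.270, (61)-(63) pp.271-272] -/
theorem remainderSmallOwnΦ_of_jets_profileRows (q : ∀ K, AlphaInputsT3AC.PkgCoreRows F 𝔠 γ hγ hγ1 K) {Φ : ChartFam ↥(lieC (suGroupModel 2)) F} {e : VacFam F}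
    {B : CfgFam ↥(lieC (suGroupModel 2)) F} {p₁ : ℝ} (hp : 𝔠.p₀ + 𝔠.r₀ ≤ p₁)
    (hNew : NewLevelIsBirthRows q Φ e B) (hOld : OldTermsAreJetsOwnRows q Φ e B) :
    RemainderSmallOwnΦ (AlphaInputsT3AC.dataOfCoreRows q (canonPolymerRows q)) (residualRemRows q Φ e B) 𝔠.b₀ p₁ 𝔠.κ
      ((𝔠.Cfar * 𝔠.C25 * tlConst (7 * 𝔠.r₀) 1 + 𝔠.Cfar * 𝔠.C63) * ((Real.sqrt F.L)⁻¹ * (1 + Real.log (Real.sqrt F.L)) ^ p₁) ^ 7) := by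
  have hC : 0 ≤ (𝔠.Cfar * 𝔠.C25 * tlConst (7 * 𝔠.r₀) 1 + 𝔠.Cfar * 𝔠.C63) * ((Real.sqrt F.L)⁻¹ * (1 + Real.log (Real.sqrt F.L)) ^ p₁) ^ 7 := by
    have := 𝔠.Cfar_nonneg; have := 𝔠.C25_nonneg; have := 𝔠.C63_nonneg
    have := tlConst_nonneg (q := 7 * 𝔠.r₀) (c := 1) (by linarith [𝔠.one_le_r₀]) one_pos
    have := heightUpFactor_nonneg (F := F) p₁
    positivity
  exact remainderSmallOwnΦ_of_splitRows q F.hL.2.le hγ (hγ1.trans (sq_min_one_le _ 𝔠.gamma0_pos)) 𝔠.b₀_pos hC hNew hOld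
    (birthFarSmallOwnRows_of_record q hp)

/-- The same at the χ-record's datum (`q := toCore ∘ p`). [cite: Balaban1985UV3, (43) p.266, (57) p.270, (61)-(63) pp.271-272] -/
theorem remainderSmallOwnΦ_chiV4_of_jets_profile (p : ∀ K, AlphaInputsT3AC.PkgAtV4Chi F 𝔠 γ hγ hγ1 K) {Φ : ChartFam ↥(lieC (suGroupModel 2)) F} {e : VacFam F}
    {B : CfgFam ↥(lieC (suGroupModel 2)) F} {p₁ : ℝ} (hp : 𝔠.p₀ + 𝔠.r₀ ≤ p₁)
    (hNew : NewLevelIsBirthRows (fun K => (p K).toRows) Φ e B) (hOld : OldTermsAreJetsOwnRows (fun K => (p K).toRows) Φ e B) :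
    RemainderSmallOwnΦ (AlphaInputsT3AC.dataOfV4chi p (canonPolymerRows fun K => (p K).toRows)) (residualRemRows (fun K => (p K).toRows) Φ e B)
      𝔠.b₀ p₁ 𝔠.κ ((𝔠.Cfar * 𝔠.C25 * tlConst (7 * 𝔠.r₀) 1 + 𝔠.Cfar * 𝔠.C63) * ((Real.sqrt F.L)⁻¹ * (1 + Real.log (Real.sqrt F.L)) ^ p₁) ^ 7) :=
  remainderSmallOwnΦ_of_jets_profileRows (fun K => (p K).toRows) hp hNew hOld

end Residual

end Summit.QuantumFields.YangMills.Theorems.GlobalSlackKernelLeg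

end
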